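import Literature.Barriers.AtomisticToContinuum.AnticontinuumLocalizationNormalForm
import Literature.MathematicalPhysics.KineticTheory.TrigPolySymbol
import Mathlib.Analysis.Calculus.Deriv.ZPow
import Mathlib.Analysis.Calculus.IteratedDeriv.Lemmas
import Mathlib.Analysis.Normed.Group.Bounded
import HarnessLib

/-!
# De Roeck–Huveneers 2015, §3.3 for the rotor chain: the `δ`-bookkeeping (3.12)–(3.14) of the scheme

`Literature/Barriers/AtomisticToContinuum/` — continuation of `AnticontinuumLocalizationNormalForm.lean`.
For the explicit objects of the perturbative scheme of W. De Roeck, F. Huveneers, CPAM 68 (2015),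
arXiv:1305.5127, §3 (stages `stage m γ n k`, generators `gen m γ n k`, perturbative Hamiltonian
`normalForm`), this file PROVES the `δ`-dependence claims (3.12)–(3.14) in the form of the symbol
classes of `Literature/Analysis/Calculus/DeltaSymbolClasses.lean`:

* the cut-off profile has bounded derivatives of all orders (`cutoff_iteratedFDeriv_bound`), and so has
  its divided profile `φ(s) = (1 - ρ(s))/s` (`cutDivOne_iteratedFDeriv_bound`: `φ = 1/s` for `|s| ≥ 2`,
  `iter_deriv_inv`, and compactness on `[-3, 3]`);
* `H = D + εV` is of order `0` (`hamSeries_inClass`);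
* **(3.14)**: every component `j` of every stage is "`∼ δ^{-2(j-1)}`" (`stage_inClass`, with `2(j-1) = 0`
  for `j = 0, 1`), the generators satisfy `U^{(k)} ∼ δ^{-(2k-1)}` (`gen_inClass`), hence
  `H̃^{(k)} ∼ δ^{-2(k-1)}` (`normalForm_inClass`, eq. (3.12)) — with the SHARP arithmetic of the proof
  of (3.14) (`S^{(k)}D ∼ δ^{-2k}` through the homological equation, built into `SymSeries.expOpD`).

No named facts.
-/

noncomputable section

open Function Set Finset Filter Metric
open scoped ContDiff BigOperators Topology

namespace Literature.Barriers.AtomisticToContinuum.HeatConduction.RotorChain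

open Literature.MathematicalPhysics.KineticTheory.HeatConduction
open Literature.Analysis.Calculus Literature.Analysis.Calculus.IsDeltaSymbol
open Literature.Algebra.Lie Literature.Algebra.Lie.TruncSeries

variable {m : ℕ}

/-! ### Derivative bounds for the cut-off profile and its divided profile -/

/-- A smooth compactly supported function on `ℝ` has bounded derivatives of all orders. [folklore] -/
theorem iteratedFDeriv_bound_of_hasCompactSupport {f : ℝ → ℝ} (hf : ContDiff ℝ ∞ f) (hc : HasCompactSupport f)
    (i : ℕ) : ∃ B : ℝ, 0 ≤ B ∧ ∀ s : ℝ, ‖iteratedFDeriv ℝ i f s‖ ≤ B := by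
  have hcont : Continuous (iteratedFDeriv ℝ i f) := hf.continuous_iteratedFDeriv (by exact_mod_cast le_top)
  obtain ⟨C, hC⟩ := hcont.bounded_above_of_compact_support (hc.iteratedFDeriv i)
  exact ⟨max C 0, le_max_right _ _, fun s => (hC s).trans (le_max_left _ _)⟩

/-- **The cut-off profile has bounded derivatives of all orders.** [cite: DeRoeckHuveneers2015, §3.2 ("smooth, bounded functions … with bounded derivatives of all order")] -/
theorem cutoff_iteratedFDeriv_bound (i : ℕ) : ∃ B : ℝ, 0 ≤ B ∧ ∀ s : ℝ, ‖iteratedFDeriv ℝ i cutoff s‖ ≤ B :=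
  iteratedFDeriv_bound_of_hasCompactSupport contDiff_cutoff
    (by
      have h : HasCompactSupport (cutoffBump : ℝ → ℝ) := cutoffBump.hasCompactSupport
      have e : cutoff = (cutoffBump : ℝ → ℝ) := funext fun s => rfl
      rw [e]; exact h) i

/-- The divided profile `φ(s) = (1 - ρ(s))/s` is `1/s` for `|s| > 2`, locally. [cite: DeRoeckHuveneers2015, §3.1] -/
theorem cutDivOne_eventuallyEq_inv {s : ℝ} (hs : 2 < |s|) :
    (TrigTerm.cutDiv cutoff 1) =ᶠ[𝓝 s] (Inv.inv : ℝ → ℝ) := by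
  have hopen : IsOpen {s : ℝ | 2 < |s|} := isOpen_lt continuous_const continuous_abs
  filter_upwards [hopen.mem_nhds hs] with s' hs'
  have hs'' : 2 ≤ |s'| := le_of_lt hs'
  simp only [TrigTerm.cutDiv, div_one, cutoff_eq_zero hs'', sub_zero, one_div]

/-- The divided profile is smooth. [cite: DeRoeckHuveneers2015, §3.1] -/
theorem contDiff_cutDivOne : ContDiff ℝ ∞ (TrigTerm.cutDiv cutoff 1) :=
  TrigTerm.contDiff_cutDiv contDiff_cutoff cutoff_eventually_one 1

/-- **The divided profile `φ(s) = (1 - ρ(s))/s` has bounded derivatives of all orders**: on `[-3, 3]` by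
compactness, outside by `|φ^{(i)}(s)| = i!/|s|^{i+1} ≤ i!`. [cite: DeRoeckHuveneers2015, §3.3 proof of (3.14)] -/
theorem cutDivOne_iteratedFDeriv_bound (i : ℕ) :
    ∃ B : ℝ, 0 ≤ B ∧ ∀ s : ℝ, ‖iteratedFDeriv ℝ i (TrigTerm.cutDiv cutoff 1) s‖ ≤ B := by
  set φ := TrigTerm.cutDiv cutoff 1 with hφ
  have hcont : Continuous (iteratedFDeriv ℝ i φ) :=
    contDiff_cutDivOne.continuous_iteratedFDeriv (by exact_mod_cast le_top)
  obtain ⟨B₁, hB₁⟩ := (isCompact_Icc (a := (-3 : ℝ)) (b := 3)).exists_bound_of_continuousOn hcont.continuousOn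
  refine ⟨max (max B₁ 0) (i.factorial : ℝ), le_trans (le_max_right _ _) (le_max_left _ _), fun s => ?_⟩
  by_cases hs : s ∈ Icc (-3 : ℝ) 3
  · exact (hB₁ s hs).trans ((le_max_left _ _).trans (le_max_left _ _))
  · -- `|s| > 3 > 2`: `φ = 1/s` near `s`
    have hs3 : 3 < |s| := by
      simp only [Set.mem_Icc, not_and_or, not_le] at hs
      rcases hs with h | h
      · rw [abs_of_neg (by linarith)]; linarith
      · rw [abs_of_pos (by linarith)]; linarith
    have hs2 : 2 < |s| := by linarith
    have hs0 : s ≠ 0 := by intro h; rw [h, abs_zero] at hs3; linarith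
    rw [norm_iteratedFDeriv_eq_norm_iteratedDeriv, (cutDivOne_eventuallyEq_inv hs2).iteratedDeriv_eq i,
      iteratedDeriv_eq_iterate, iter_deriv_inv]
    refine le_trans ?_ (le_max_right _ _)
    rw [norm_mul, norm_mul, norm_pow, norm_neg, norm_one, one_pow, one_mul, Real.norm_natCast]
    refine mul_le_of_le_one_right (Nat.cast_nonneg _) ?_
    rw [show (-1 - i : ℤ) = -((i + 1 : ℕ) : ℤ) by push_cast; ring, zpow_neg, zpow_natCast, norm_inv, norm_pow,
      Real.norm_eq_abs]
    exact inv_le_one_of_one_le₀ (one_le_pow₀ (by linarith))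

/-! ### Classes of the Hamiltonian and of the scheme -/

/-- `D` is of order `0` (coefficients `½ω_y²`, polynomial). [cite: DeRoeckHuveneers2015, §3.3 (3.14) (`k = 1`)] -/
theorem kinPoly_inClass (m : ℕ) : (kinPoly m).InClass 0 := by
  intro t ht
  rw [kinPoly, List.mem_ofFn] at ht
  obtain ⟨y, rfl⟩ := ht
  refine ⟨?_, IsDeltaSymbol.const (E := Fin m → ℝ) 0⟩
  have h := isDeltaSymbol_div_two ((isDeltaSymbol_coord (m := m) y).mul (isDeltaSymbol_coord y))
  refine isDeltaSymbol_congr h fun δ _ _ => ?_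
  funext w
  simp [kinTerm, sq]

/-- `V` is of order `0` (constant coefficients). [cite: DeRoeckHuveneers2015, §3.3 (3.14) (`k = 1`)] -/
theorem potPoly_inClass (m : ℕ) (γ : ℝ) : (potPoly m γ).InClass 0 := by
  intro t ht
  rw [potPoly, List.mem_flatMap] at ht
  obtain ⟨y, -, hty⟩ := ht
  unfold potTerms at hty
  rcases List.mem_append.1 hty with h | h
  · simp only [List.mem_cons, List.mem_nil_iff, or_false] at h
    rcases h with rfl | rfl <;> exact ⟨IsDeltaSymbol.const _, IsDeltaSymbol.const _⟩
  · by_cases hb : y.val + 1 < m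
    · rw [dif_pos hb] at h
      simp only [List.mem_cons, List.mem_nil_iff, or_false] at h
      rcases h with rfl | rfl <;> exact ⟨IsDeltaSymbol.const _, IsDeltaSymbol.const _⟩
    · rw [dif_neg hb] at h; simp at h

/-- `H = (D, V, 0, …)` has components of order `2(j - 1)` (`= 0` for `j = 0, 1`). [cite: DeRoeckHuveneers2015, §3.3 (3.14)] -/
theorem hamSeries_inClass (m : ℕ) (γ : ℝ) (n : ℕ) : ∀ j ≤ n, (hamSeries m γ j).InClass (2 * (j - 1)) := by
  intro j _
  unfold hamSeries
  by_cases h0 : j = 0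
  · rw [if_pos h0]; exact (kinPoly_inClass m).mono (Nat.zero_le _)
  · rw [if_neg h0]
    by_cases h1 : j = 1
    · rw [if_pos h1]; exact (potPoly_inClass m γ).mono (Nat.zero_le _)
    · rw [if_neg h1]; exact TrigPoly.inClass_nil _

/-- Arithmetic of the sharp scheme, generic contributions: for `i(k+1) < j`:
`2((j - i(k+1)) - 1) + i(2k + 2) ≤ 2(j - 1)`. [cite: DeRoeckHuveneers2015, §3.3 proof of (3.14)] -/
theorem sharp_arith_lt {i j k : ℕ} (h : i * (k + 1) < j) :
    2 * (j - i * (k + 1) - 1) + i * (2 * k + 1 + 1) ≤ 2 * (j - 1) := by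
  have e : i * (2 * k + 1 + 1) = 2 * (i * (k + 1)) := by ring
  rw [e]
  omega

/-- Arithmetic of the sharp scheme, contributions hitting `D`: for `1 ≤ i`, `i(k+1) = j`:
`2k + (i - 1)(2k + 2) ≤ 2(j - 1)`. [cite: DeRoeckHuveneers2015, §3.3 proof of (3.14) ("`S^{(k)}D ∼ δ^{-2k}`")] -/
theorem sharp_arith_eq {i j k : ℕ} (hi : 1 ≤ i) (h : i * (k + 1) = j) :
    2 * k + (i - 1) * (2 * k + 1 + 1) ≤ 2 * (j - 1) := by
  obtain ⟨i', rfl⟩ : ∃ i', i = i' + 1 := ⟨i - 1, by omega⟩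
  rw [Nat.add_sub_cancel]
  have e : i' * (2 * k + 1 + 1) = 2 * (i' * (k + 1)) := by ring
  have e2 : (i' + 1) * (k + 1) = i' * (k + 1) + (k + 1) := by ring
  rw [e]
  omega

/-- **(3.14) for the rotor chain**: every component `j` of every stage of the scheme is "`∼ δ^{-2(j-1)}`".
[cite: DeRoeckHuveneers2015, §3.3 (3.14) ("`Q^{(k-1)} ∼ δ^{-2(k-1)}`, `S^{(k-1)}D ∼ δ^{-2(k-1)}`")] -/
theorem stage_inClass (m : ℕ) (γ : ℝ) (n : ℕ) : ∀ k, ∀ j ≤ n, (stage m γ n k j).InClass (2 * (j - 1)) := by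
  intro k
  induction k with
  | zero => exact hamSeries_inClass m γ n
  | succ k ih =>
    by_cases hk : k + 1 ≤ n
    · rw [stage_succ_of_le γ hk]
      have hP : (stage m γ n k (k + 1)).InClass (2 * k) := by
        have := ih (k + 1) hk
        simpa using this
      have hU : (TrigPoly.solve cutoff (stage m γ n k (k + 1))).InClass (2 * k + 1) :=
        hP.solve contDiff_cutDivOne cutDivOne_iteratedFDeriv_bound
      have hUD : (TrigPoly.neg (stage m γ n k (k + 1)) ++ TrigPoly.resCut cutoff (stage m γ n k (k + 1))).InClass (2 * k) :=
        hP.neg.append (hP.resCut contDiff_cutoff cutoff_iteratedFDeriv_bound)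
      have hE := SymSeries.inClass_expOpD (n := n) (p := k + 1) (rU := stageRad n k) (rS := stageRad n k)
        (cS := fun j => 2 * (j - 1)) (c := fun j => 2 * (j - 1)) hU hUD ih (fun j _ => le_rfl)
        (fun j i _ _ _ hij => sharp_arith_lt hij)
        (fun j i _ hi1 _ hij => sharp_arith_eq hi1 hij)
      refine SymSeries.inClass_update (c := fun j => 2 * (j - 1)) hE (k + 1) ?_
      simpa using hP.resCut contDiff_cutoff cutoff_iteratedFDeriv_bound
    · rw [stage_succ_of_lt γ (not_le.1 hk)]
      exact ih

/-- **`U^{(k)} ∼ δ^{-(2k-1)}`.** [cite: DeRoeckHuveneers2015, §3.3 (3.14) ("`U^{(k)} ∼ δ^{-(2k-1)}`")] -/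
theorem gen_inClass (m : ℕ) (γ : ℝ) (n : ℕ) : ∀ k, (gen m γ n k).InClass (2 * k - 1) := by
  intro k
  rcases k with _ | k
  · exact TrigPoly.inClass_nil _
  · by_cases hk : k + 1 ≤ n
    · rw [gen_succ_of_le γ hk]
      have hP : (stage m γ n k (k + 1)).InClass (2 * k) := by
        simpa using stage_inClass m γ n k (k + 1) hk
      have := hP.solve contDiff_cutDivOne cutDivOne_iteratedFDeriv_bound
      refine this.mono ?_
      omega
    · rw [gen, if_neg hk]
      exact TrigPoly.inClass_nil _

/-- **(3.12) for the rotor chain: `H̃^{(k)} ∼ δ^{-2(k-1)}`** (and `H̃^{(0)} = D ∼ δ^0`). [cite: DeRoeckHuveneers2015, §3.2 (3.12)] -/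
theorem normalForm_inClass (m : ℕ) (γ : ℝ) (n : ℕ) : ∀ j ≤ n, (normalForm m γ n j).InClass (2 * (j - 1)) :=
  stage_inClass m γ n n

/-! ### Mode bounds and resonance of the scheme -/

/-- The mode sup-norm bound after stage `k`: `mb_0 = 1`, `mb_{k+1} = mb_k + n mb_k`. [cite: DeRoeckHuveneers2015, §4.1 (`K_r`)] -/
def stageModeBound (n : ℕ) : ℕ → ℕ
  | 0 => 1
  | k + 1 => stageModeBound n k + n * stageModeBound n k

/-- `H = D + εV` has modes in `{-1, 0, 1}^m`. [cite: DeRoeckHuveneers2015, §2.1 (2.1)] -/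
theorem hamSeries_modeBound (m : ℕ) (γ : ℝ) (n : ℕ) : ∀ j ≤ n, (hamSeries m γ j).ModeBound 1 := by
  intro j _
  unfold hamSeries
  by_cases h0 : j = 0
  · rw [if_pos h0]
    intro t ht y
    rw [kinPoly, List.mem_ofFn] at ht
    obtain ⟨x, rfl⟩ := ht
    simp [kinTerm]
  · rw [if_neg h0]
    by_cases h1 : j = 1
    · rw [if_pos h1]
      intro t ht y
      rw [potPoly, List.mem_flatMap] at ht
      obtain ⟨x, -, htx⟩ := ht
      unfold potTerms at htx
      rcases List.mem_append.1 htx with h | h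
      · simp only [List.mem_cons, List.mem_nil_iff, or_false] at h
        rcases h with rfl | rfl
        · simp
        · simp only [Pi.single_apply]
          split_ifs <;> simp
      · by_cases hb : x.val + 1 < m
        · rw [dif_pos hb] at h
          simp only [List.mem_cons, List.mem_nil_iff, or_false] at h
          rcases h with rfl | rfl
          · simp
          · simp only [Pi.sub_apply, Pi.single_apply]
            split_ifs <;> simp
        · rw [dif_neg hb] at h; simp at h
    · rw [if_neg h1]; exact TrigPoly.modeBound_nil _

/-- **Modes stay bounded**: every component of stage `k` has modes of sup-norm `≤ stageModeBound n k`.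
[cite: DeRoeckHuveneers2015, §3.3 (modes of `S(Ω)`) and §4.1 (`K_r`)] -/
theorem stage_modeBound (m : ℕ) (γ : ℝ) (n : ℕ) : ∀ k, ∀ j ≤ n, (stage m γ n k j).ModeBound (stageModeBound n k) := by
  intro k
  induction k with
  | zero => exact hamSeries_modeBound m γ n
  | succ k ih =>
    by_cases hk : k + 1 ≤ n
    · rw [stage_succ_of_le γ hk]
      have hP := ih (k + 1) hk
      have hU := hP.solve cutoff
      have hUD := (hP.neg).append (hP.resCut cutoff)
      have hE := SymSeries.modeBound_expOpD (n := n) (p := k + 1) (rU := stageRad n k) (rS := stageRad n k) hU hUD ih le_rfl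
      exact SymSeries.modeBound_update hE (k + 1) ((hP.resCut cutoff).mono (Nat.le_add_right _ _))
    · rw [stage_succ_of_lt γ (not_le.1 hk)]
      exact fun j hj => (ih j hj).mono (Nat.le_add_right _ _)

/-- The generators have bounded modes. [folklore] -/
theorem gen_modeBound (m : ℕ) (γ : ℝ) (n : ℕ) : ∀ k, 1 ≤ k → (gen m γ n k).ModeBound (stageModeBound n (k - 1)) := by
  intro k hk
  obtain ⟨k, rfl⟩ : ∃ k', k = k' + 1 := ⟨k - 1, by omega⟩
  rw [Nat.add_sub_cancel]
  by_cases hkn : k + 1 ≤ n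
  · rw [gen_succ_of_le γ hkn]; exact (stage_modeBound m γ n k (k + 1) hkn).solve cutoff
  · rw [gen, if_neg hkn]; exact TrigPoly.modeBound_nil _

/-- **The components `1 ≤ k ≤ n` of `H̃` are resonant** at every scale `δ > 0` (they are `𝓡P_k`).
[cite: DeRoeckHuveneers2015, §3.2 (3.10) and §5.4 (5.12)] -/
theorem normalForm_resonantOnly {n k : ℕ} (γ : ℝ) (hk1 : 1 ≤ k) (hkn : k ≤ n) {δ : ℝ} (hδ : 0 < δ) :
    (normalForm m γ n k).ResonantOnly δ := by
  rw [normalForm_apply γ hk1 hkn]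
  exact TrigPoly.resonantOnly_resCut (fun s hs => cutoff_eq_zero hs) hδ _

/-- The component `0` of `H̃` is `D`: all its modes vanish. [cite: DeRoeckHuveneers2015, §3.2 ("`H̃^{(0)} = D`")] -/
theorem normalForm_zero_mode (γ : ℝ) (n : ℕ) {t : TrigTerm m} (ht : t ∈ normalForm m γ n 0) : t.mode = 0 := by
  rw [normalForm, stage_apply_zero, kinPoly, List.mem_ofFn] at ht
  obtain ⟨y, rfl⟩ := ht
  rfl

end Literature.Barriers.AtomisticToContinuum.HeatConduction.RotorChain

end
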